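import Mathlib.RingTheory.FiniteType
import Mathlib.RingTheory.Nilpotent.Lemmas
import Literature.RepresentationTheory.CompactGroups.PolynomialFunctionClosure
import HarnessLib

/-!
# The ring of polynomial functions on a subset of a real vector space

For a subset `C` of a finite-dimensional real normed space `𝔼`, the **ring of polynomial
functions on `C`** is the image `ℝ[C]` of the polynomial functions on `𝔼` (basis-free:
`MvPolynomial.aeval (fun ℓ : 𝔼 →L[ℝ] ℝ => ⇑ℓ) P`, file
`RepresentationTheory/CompactGroups/CompactMatrixGroupTangent`) under restriction to `C`
(Bochnak–Coste–Roy, *Real Algebraic Geometry*, Def. 3.2.1: `𝒫(C) = ℝ[x₁,…,xₙ]/I(C)`). This file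
sets up:

* `polyRestrict C : ℝ[Xℓ] →ₐ[ℝ] (C → ℝ)` (restriction of polynomial functions) and the ring
  `PolyRing C = range (polyRestrict C)`, a reduced `ℝ`-algebra of finite type
  (`finiteType_polyRing`: generated by the restrictions of the coordinates of a basis);
* the evaluation characters `evalAt C hc : PolyRing C →ₐ[ℝ] ℝ` at points `c ∈ C`, and an
  element of `PolyRing C` vanishes iff it vanishes at every point;
* **points of `Spec ℝ[C]` with values in `ℝ` are the points of the real Zariski closure of `C`**:
  if `C` is *real Zariski closed* (every point off `C` is separated from `C` by a polynomial
  vanishing on `C`), every `ℝ`-algebra character of `PolyRing C` is `evalAt` at a unique point of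
  `C` (`exists_eq_evalAt`; BCR Prop. 3.2.3 / the real Nullstellensatz is NOT needed for this
  elementary direction);
* the automorphism `pullbackEquiv` of `PolyRing C` induced by an affine automorphism of `𝔼`
  preserving `C` (`evalAt c ∘ pullback = evalAt (A c + v)`), and the lemma that polynomial
  functions are stable under affine changes of variables (`exists_aeval_coeFn_comp_affine`).

This is the algebraic half of the construction of a smooth real algebraic model of a homogeneous
real-Zariski-closed set (compact linear groups: Chevalley 1946; Onishchik–Vinberg Ch. 3 §3), file
`RealAlgebraic/HomogeneousAlgebraicModel`. Only genuine definitions are introduced (with bodies);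
no named facts.

## References

* J. Bochnak, M. Coste, M.-F. Roy, *Real Algebraic Geometry* (1998), Def. 3.2.1, §3.2.
  [BochnakCosteRoy1998]
* A. L. Onishchik, E. B. Vinberg, *Lie Groups and Algebraic Groups* (1990), Ch. 3 §3 (polynomial
  functions, real algebraic groups). [OnishchikVinberg1990]
-/

noncomputable section

open Set MvPolynomial Function

namespace Literature.AlgebraicGeometry.RealAlgebraic

open Literature.RepresentationTheory.CompactGroups

universe u

variable {𝔼 : Type u} [NormedAddCommGroup 𝔼] [NormedSpace ℝ 𝔼]

/-! ### Polynomial functions under affine changes of variables -/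

/-- **Polynomial functions are stable under affine substitutions**: for `A : 𝔼 → 𝔼` continuous
linear and `v ∈ 𝔼`, `x ↦ P(A x + v)` is again a polynomial function. [folklore] -/
theorem exists_aeval_coeFn_comp_affine (P : MvPolynomial (𝔼 →L[ℝ] ℝ) ℝ) (A : 𝔼 →L[ℝ] 𝔼) (v : 𝔼) :
    ∃ P' : MvPolynomial (𝔼 →L[ℝ] ℝ) ℝ, ∀ x : 𝔼,
      MvPolynomial.aeval (R := ℝ) (fun ℓ : 𝔼 →L[ℝ] ℝ => (ℓ : 𝔼 → ℝ)) P' x =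
        MvPolynomial.aeval (R := ℝ) (fun ℓ : 𝔼 →L[ℝ] ℝ => (ℓ : 𝔼 → ℝ)) P (A x + v) := by
  induction P using MvPolynomial.induction_on with
  | C a =>
    refine ⟨MvPolynomial.C a, fun x => ?_⟩
    simp only [MvPolynomial.algHom_C]
    rfl
  | add p q hp hq =>
    obtain ⟨P', hP'⟩ := hp
    obtain ⟨Q', hQ'⟩ := hq
    refine ⟨P' + Q', fun x => ?_⟩
    rw [map_add, map_add, Pi.add_apply, Pi.add_apply, hP', hQ']
  | mul_X p ℓ hp =>
    obtain ⟨P', hP'⟩ := hp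
    obtain ⟨Q, hQ⟩ := exists_aeval_coeFn_eq_add (exists_aeval_coeFn_eq_clm (ℓ.comp A))
      (exists_aeval_coeFn_eq_const (E := 𝔼) (ℓ v))
    refine ⟨P' * Q, fun x => ?_⟩
    rw [map_mul, map_mul, Pi.mul_apply, Pi.mul_apply, hP', hQ, MvPolynomial.aeval_X]
    change _ * (ℓ (A x) + ℓ v) = _ * ℓ (A x + v)
    rw [map_add]

/-! ### The restriction homomorphism and the ring `ℝ[C]` -/

/-- Restriction of polynomial functions on `𝔼` to the subset `C`, as an `ℝ`-algebra homomorphism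
`ℝ[X_ℓ : ℓ ∈ 𝔼*] → (C → ℝ)`. [cite: BochnakCosteRoy1998, Def. 3.2.1] -/
def polyRestrict (C : Set 𝔼) : MvPolynomial (𝔼 →L[ℝ] ℝ) ℝ →ₐ[ℝ] (C → ℝ) where
  toFun P c := MvPolynomial.aeval (R := ℝ) (fun ℓ : 𝔼 →L[ℝ] ℝ => (ℓ : 𝔼 → ℝ)) P c
  map_one' := by funext c; simp
  map_mul' P Q := by funext c; simp
  map_zero' := by funext c; simp
  map_add' P Q := by funext c; simp
  commutes' a := by
    funext c
    change MvPolynomial.aeval (R := ℝ) (fun ℓ : 𝔼 →L[ℝ] ℝ => (ℓ : 𝔼 → ℝ)) (MvPolynomial.C a)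
      (c : 𝔼) = a
    rw [MvPolynomial.algHom_C]
    rfl

/-- Unfolding of `polyRestrict`. [folklore] -/
@[simp]
theorem polyRestrict_apply (C : Set 𝔼) (P : MvPolynomial (𝔼 →L[ℝ] ℝ) ℝ) (c : C) :
    polyRestrict C P c =
      MvPolynomial.aeval (R := ℝ) (fun ℓ : 𝔼 →L[ℝ] ℝ => (ℓ : 𝔼 → ℝ)) P (c : 𝔼) :=
  rfl

/-- **The ring of polynomial functions on `C`**, `ℝ[C] = {P|_C}` (the coordinate ring
`ℝ[x]/I(C)` of the real Zariski closure of `C`, realised inside the functions on `C`).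
[cite: BochnakCosteRoy1998, Def. 3.2.1] -/
abbrev PolyRing (C : Set 𝔼) : Type u :=
  ↥(polyRestrict C).range

variable (C : Set 𝔼)

/-- Every element of `ℝ[C]` is the restriction of a polynomial function. [folklore] -/
theorem exists_polyRestrict_eq (r : PolyRing C) :
    ∃ P : MvPolynomial (𝔼 →L[ℝ] ℝ) ℝ, (⟨polyRestrict C P, P, rfl⟩ : PolyRing C) = r := by
  obtain ⟨r, P, rfl⟩ := r
  exact ⟨P, rfl⟩

/-- `ℝ[C]` is reduced (a subring of the ring of all real functions on `C`). [folklore] -/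
instance isReduced_polyRing : IsReduced (PolyRing C) :=
  isReduced_of_injective (polyRestrict C).range.val Subtype.val_injective

/-- The coordinate expansion of a functional: `ℓ x = Σᵢ xᵢ ℓ(bᵢ)` in a basis `b`. [folklore] -/
theorem clm_apply_eq_sum_coord [FiniteDimensional ℝ 𝔼] (ℓ : 𝔼 →L[ℝ] ℝ) (x : 𝔼) :
    ℓ x = ∑ i, (Module.finBasis ℝ 𝔼).coord i x * ℓ (Module.finBasis ℝ 𝔼 i) := by
  conv_lhs => rw [← (Module.finBasis ℝ 𝔼).sum_repr x]
  rw [map_sum]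
  refine Finset.sum_congr rfl fun i _ => ?_
  rw [map_smul, smul_eq_mul, Module.Basis.coord_apply]

/-- **`ℝ[C]` is an `ℝ`-algebra of finite type**: it is generated by the restrictions of the
coordinate functions of a basis. [cite: BochnakCosteRoy1998, Def. 3.2.1] -/
instance finiteType_polyRing [FiniteDimensional ℝ 𝔼] : Algebra.FiniteType ℝ (PolyRing C) := by
  classical
  set b := Module.finBasis ℝ 𝔼 with hb
  -- the coordinate functionals and the finite presentation of the same range
  set crd : Fin (Module.finrank ℝ 𝔼) → (𝔼 →L[ℝ] ℝ) := fun i =>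
    LinearMap.toContinuousLinearMap (b.coord i) with hcrd
  set ψ : MvPolynomial (Fin (Module.finrank ℝ 𝔼)) ℝ →ₐ[ℝ] (C → ℝ) :=
    (polyRestrict C).comp (MvPolynomial.aeval fun i => MvPolynomial.X (crd i)) with hψ
  have hmem : ∀ P : MvPolynomial (𝔼 →L[ℝ] ℝ) ℝ, polyRestrict C P ∈ ψ.range := by
    intro P
    induction P using MvPolynomial.induction_on with
    | C a =>
      refine (AlgHom.mem_range ψ).2 ⟨MvPolynomial.C a, ?_⟩
      simp only [MvPolynomial.algHom_C]
    | add p q hp hq =>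
      rw [map_add]
      exact ψ.range.add_mem hp hq
    | mul_X p ℓ hp =>
      rw [map_mul]
      refine ψ.range.mul_mem hp ?_
      have hX : polyRestrict C (MvPolynomial.X ℓ) =
          ∑ i, ℓ (b i) • polyRestrict C (MvPolynomial.X (crd i)) := by
        funext c
        rw [Finset.sum_apply]
        simp only [polyRestrict_apply, MvPolynomial.aeval_X, Pi.smul_apply, smul_eq_mul]
        rw [clm_apply_eq_sum_coord ℓ (c : 𝔼)]
        refine Finset.sum_congr rfl fun i _ => ?_
        rw [mul_comm]
        rfl
      rw [hX]
      refine sum_mem fun i _ => Subalgebra.smul_mem _ ?_ _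
      refine (AlgHom.mem_range ψ).2 ⟨MvPolynomial.X i, ?_⟩
      rw [hψ, AlgHom.comp_apply, MvPolynomial.aeval_X]
  have hrange : ψ.range = (polyRestrict C).range := by
    apply le_antisymm
    · rintro _ ⟨p, rfl⟩
      exact ⟨_, rfl⟩
    · rintro _ ⟨P, rfl⟩
      exact hmem P
  have hft : Algebra.FiniteType ℝ ψ.range := by
    refine Algebra.FiniteType.of_surjective ψ.rangeRestrict ?_
    rintro ⟨y, p, rfl⟩
    exact ⟨p, rfl⟩
  exact hft.equiv (Subalgebra.equivOfEq _ _ hrange)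

/-! ### Evaluation characters -/

variable {C}

/-- Evaluation of polynomial functions on `C` at a point `c ∈ C`, an `ℝ`-algebra character of
`ℝ[C]`. [cite: BochnakCosteRoy1998, §3.2] -/
def evalAt {c : 𝔼} (hc : c ∈ C) : PolyRing C →ₐ[ℝ] ℝ :=
  (Pi.evalAlgHom ℝ (fun _ : C => ℝ) ⟨c, hc⟩).comp (polyRestrict C).range.val

/-- Unfolding of `evalAt`. [folklore] -/
@[simp]
theorem evalAt_apply {c : 𝔼} (hc : c ∈ C) (r : PolyRing C) : evalAt hc r = r.1 ⟨c, hc⟩ :=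
  rfl

/-- `evalAt` on a restricted polynomial is the value of the polynomial. [folklore] -/
theorem evalAt_polyRestrict {c : 𝔼} (hc : c ∈ C) (P : MvPolynomial (𝔼 →L[ℝ] ℝ) ℝ) :
    evalAt hc ⟨polyRestrict C P, P, rfl⟩ =
      MvPolynomial.aeval (R := ℝ) (fun ℓ : 𝔼 →L[ℝ] ℝ => (ℓ : 𝔼 → ℝ)) P c :=
  rfl

/-- An element of `ℝ[C]` vanishes iff it vanishes at every point of `C`. [folklore] -/
theorem eq_zero_iff_forall_evalAt (r : PolyRing C) : r = 0 ↔ ∀ c (hc : c ∈ C), evalAt hc r = 0 := by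
  constructor
  · rintro rfl c hc
    rfl
  · intro h
    apply Subtype.ext
    funext c
    exact h c c.2

/-- **The `ℝ`-characters of `ℝ[C]` are the evaluations at the points of `C`, when `C` is real
Zariski closed** (every point off `C` is separated from `C` by a polynomial vanishing on `C`):
the character sends the coordinate functions to the coordinates of a point `z`, hence every
polynomial function to its value at `z`, and `z ∈ C` by separation. [cite: BochnakCosteRoy1998, §3.2] -/
theorem exists_eq_evalAt [FiniteDimensional ℝ 𝔼]
    (hsep : ∀ z ∉ C, ∃ P : MvPolynomial (𝔼 →L[ℝ] ℝ) ℝ,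
      (∀ c ∈ C, MvPolynomial.aeval (R := ℝ) (fun ℓ : 𝔼 →L[ℝ] ℝ => (ℓ : 𝔼 → ℝ)) P c = 0) ∧
        MvPolynomial.aeval (R := ℝ) (fun ℓ : 𝔼 →L[ℝ] ℝ => (ℓ : 𝔼 → ℝ)) P z ≠ 0)
    (e : PolyRing C →ₐ[ℝ] ℝ) : ∃ (c : 𝔼) (hc : c ∈ C), e = evalAt hc := by
  classical
  set b := Module.finBasis ℝ 𝔼 with hb
  set crd : Fin (Module.finrank ℝ 𝔼) → (𝔼 →L[ℝ] ℝ) := fun i =>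
    LinearMap.toContinuousLinearMap (b.coord i) with hcrd
  -- the character on polynomials and the candidate point
  set et : MvPolynomial (𝔼 →L[ℝ] ℝ) ℝ →ₐ[ℝ] ℝ := e.comp (polyRestrict C).rangeRestrict with het
  have het_apply : ∀ P, et P = e ⟨polyRestrict C P, P, rfl⟩ := fun P => rfl
  set z : 𝔼 := ∑ i, et (MvPolynomial.X (crd i)) • b i with hz
  have hcoord : ∀ i, b.coord i z = et (MvPolynomial.X (crd i)) := by
    intro i
    rw [hz, map_sum]
    simp only [map_smul, smul_eq_mul]
    rw [Finset.sum_eq_single i]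
    · rw [show b.coord i (b i) = 1 by simp [Module.Basis.coord_apply], mul_one]
    · intro j _ hji
      rw [show b.coord i (b j) = 0 by simp [Module.Basis.coord_apply, hji]]
      exact mul_zero _
    · intro h; exact absurd (Finset.mem_univ i) h
  -- `et = evaluation at z`
  have hkey : et = (Pi.evalAlgHom ℝ (fun _ : 𝔼 => ℝ) z).comp
      (MvPolynomial.aeval fun ℓ : 𝔼 →L[ℝ] ℝ => (ℓ : 𝔼 → ℝ)) := by
    refine MvPolynomial.algHom_ext fun ℓ => ?_
    have hr : ((Pi.evalAlgHom ℝ (fun _ : 𝔼 => ℝ) z).comp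
        (MvPolynomial.aeval fun ℓ : 𝔼 →L[ℝ] ℝ => (ℓ : 𝔼 → ℝ))) (MvPolynomial.X ℓ) = ℓ z := by
      rw [AlgHom.comp_apply, MvPolynomial.aeval_X]
      rfl
    rw [hr]
    have hX : (polyRestrict C).rangeRestrict (MvPolynomial.X ℓ) =
        ∑ i, ℓ (b i) • (polyRestrict C).rangeRestrict (MvPolynomial.X (crd i)) := by
      apply Subtype.ext
      rw [AddSubmonoidClass.coe_finsetSum]
      funext c
      rw [Finset.sum_apply]
      change polyRestrict C (MvPolynomial.X ℓ) c =
        ∑ i, (ℓ (b i) • (polyRestrict C (MvPolynomial.X (crd i)))) c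
      simp only [polyRestrict_apply, MvPolynomial.aeval_X, Pi.smul_apply, smul_eq_mul]
      rw [clm_apply_eq_sum_coord ℓ (c : 𝔼)]
      refine Finset.sum_congr rfl fun i _ => ?_
      rw [mul_comm]
      rfl
    rw [het, AlgHom.comp_apply, hX, map_sum, clm_apply_eq_sum_coord ℓ z]
    refine Finset.sum_congr rfl fun i _ => ?_
    rw [map_smul, smul_eq_mul, hcoord i, mul_comm]
    rfl
  have hval : ∀ P, e ⟨polyRestrict C P, P, rfl⟩ =
      MvPolynomial.aeval (R := ℝ) (fun ℓ : 𝔼 →L[ℝ] ℝ => (ℓ : 𝔼 → ℝ)) P z := by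
    intro P
    rw [← het_apply, hkey]
    rfl
  -- `z ∈ C` by separation
  have hzC : z ∈ C := by
    by_contra hzC
    obtain ⟨P, hPC, hPz⟩ := hsep z hzC
    have h0 : (⟨polyRestrict C P, P, rfl⟩ : PolyRing C) = 0 := by
      apply Subtype.ext
      funext c
      exact hPC c c.2
    have := hval P
    rw [h0, map_zero] at this
    exact hPz this.symm
  refine ⟨z, hzC, ?_⟩
  apply AlgHom.ext
  intro r
  obtain ⟨P, rfl⟩ := exists_polyRestrict_eq C r
  rw [hval P, evalAt_polyRestrict]

/-! ### Affine automorphisms of `𝔼` preserving `C` act on `ℝ[C]` -/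

/-- Pull-back of polynomial functions on `C` along an affine map `x ↦ A x + v` mapping `C` into
`C`, an `ℝ`-algebra endomorphism of `ℝ[C]`. [cite: OnishchikVinberg1990, Ch. 3 §3] -/
def pullback (A : 𝔼 →L[ℝ] 𝔼) (v : 𝔼) (hAv : ∀ x ∈ C, A x + v ∈ C) :
    PolyRing C →ₐ[ℝ] PolyRing C where
  toFun r := ⟨fun c => r.1 ⟨A c + v, hAv c c.2⟩, by
    obtain ⟨-, P, rfl⟩ := r
    obtain ⟨P', hP'⟩ := exists_aeval_coeFn_comp_affine P A v
    exact ⟨P', funext fun c => hP' c⟩⟩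
  map_one' := rfl
  map_mul' _ _ := rfl
  map_zero' := rfl
  map_add' _ _ := rfl
  commutes' _ := rfl

/-- Evaluation after pull-back is evaluation at the image point. [folklore] -/
@[simp]
theorem evalAt_pullback (A : 𝔼 →L[ℝ] 𝔼) (v : 𝔼) (hAv : ∀ x ∈ C, A x + v ∈ C) {c : 𝔼}
    (hc : c ∈ C) (r : PolyRing C) :
    evalAt hc (pullback A v hAv r) = evalAt (hAv c hc) r :=
  rfl

/-- **An affine automorphism of `𝔼` preserving `C` induces an automorphism of `ℝ[C]`.**
[cite: OnishchikVinberg1990, Ch. 3 §3] -/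
def pullbackEquiv (A : 𝔼 ≃L[ℝ] 𝔼) (v : 𝔼) (hAv : ∀ x ∈ C, A x + v ∈ C)
    (hAv' : ∀ x ∈ C, A.symm x + (-A.symm v) ∈ C) : PolyRing C ≃ₐ[ℝ] PolyRing C :=
  AlgEquiv.ofAlgHom (pullback (A : 𝔼 →L[ℝ] 𝔼) v hAv)
    (pullback (A.symm : 𝔼 →L[ℝ] 𝔼) (-A.symm v) hAv')
    (by
      apply AlgHom.ext
      intro r
      apply Subtype.ext
      funext c
      change r.1 ⟨A.symm (A c + v) + -A.symm v, _⟩ = r.1 c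
      have hc : (⟨A.symm (A c + v) + -A.symm v, hAv' _ (hAv c c.2)⟩ : C) = c :=
        Subtype.ext (by simp)
      rw [hc])
    (by
      apply AlgHom.ext
      intro r
      apply Subtype.ext
      funext c
      change r.1 ⟨A (A.symm c + -A.symm v) + v, _⟩ = r.1 c
      have hc : (⟨A (A.symm c + -A.symm v) + v, hAv _ (hAv' c c.2)⟩ : C) = c :=
        Subtype.ext (by simp)
      rw [hc])

/-- Evaluation after the pull-back automorphism is evaluation at the image point. [folklore] -/
theorem evalAt_pullbackEquiv (A : 𝔼 ≃L[ℝ] 𝔼) (v : 𝔼) (hAv : ∀ x ∈ C, A x + v ∈ C)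
    (hAv' : ∀ x ∈ C, A.symm x + (-A.symm v) ∈ C) {c : 𝔼} (hc : c ∈ C) (r : PolyRing C) :
    evalAt hc (pullbackEquiv A v hAv hAv' r) = evalAt (hAv c hc) r :=
  rfl

/-- The kernel of `evalAt` transforms under pull-back: `comap (pullbackEquiv) (ker evalAt c) =
ker evalAt (A c + v)`. [folklore] -/
theorem comap_pullbackEquiv_ker_evalAt (A : 𝔼 ≃L[ℝ] 𝔼) (v : 𝔼) (hAv : ∀ x ∈ C, A x + v ∈ C)
    (hAv' : ∀ x ∈ C, A.symm x + (-A.symm v) ∈ C) {c : 𝔼} (hc : c ∈ C) :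
    Ideal.comap (pullbackEquiv A v hAv hAv' : PolyRing C →+* PolyRing C)
      (RingHom.ker (evalAt hc : PolyRing C →+* ℝ)) =
      RingHom.ker (evalAt (hAv c hc) : PolyRing C →+* ℝ) := by
  ext r
  rw [Ideal.mem_comap, RingHom.mem_ker, RingHom.mem_ker]
  exact Iff.rfl

end Literature.AlgebraicGeometry.RealAlgebraic

end
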